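import Summits.ResolutionOfSingularities.ResolutionOfSingularities.Theorems.AQSHeightTwoSlope
import Summits.ResolutionOfSingularities.ResolutionOfSingularities.Theorems.WeightedInvariantHypersurfaceLocalGameEFTDimTwoNewtonFace
import HarnessLib

/-!
# Abramovich–Quek–Schober at a height-two point, III′: the slope package of K7's case (C)

Topic: `Summits/ResolutionOfSingularities/ResolutionOfSingularities/Theorems`. Helper for the door item
`HypersurfaceCentreConstruction` (statement `stmt-ResolutionOfSingularities-19897`, route `WeightedInvariant`), line
`local-engine`, ORDER (o25) «F-AQS-T in the kernel» of `res-L1-w43-plan-1` (2026-08-27T09:19:49Z), piece (α3) of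
`plan/tools/res-type-092/o25/O25-DESIGN.md` — the CASE-(C) WRAPPER over res-D-pv-023's (AS res-L1-type-o7) brick
`AQSHeightTwoSlope.lean` (p522538: `exists_slope_of_unitExpansion`, `slope_eq_of_unitExpansions`), written by the (o25) lead
res-type-092 for the assembly (α4).

[OURS · L1 W4.3] In K7's case (C) — `f` prepared at level `b` in `(x, y)` (`f - c y^ν ∈ 𝒥_{bν+1}((x,y);(1,b))`, `c` a unit) and
`f ∉ 𝒥_{(b+1)ν}((x,y);(1,b+1))` — the vertex `δ = r/q` of Abramovich–Quek–Schober's characteristic polygon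
(arXiv:2507.01232, Def. 3.2) lies in `(b, b+1)`, `y` carries `f` at slope `r/q` and at NO steeper slope (any level: a second
expansion of high enough order has the same first slope), and the `(q, r)`-face has a second exponent.  NOT a statement of the
manuscript under review (Hironaka 2017); nothing here is a claim about resolution of singularities.  AI work, weaker than
expert review.  Def-free.

## References

* D. Abramovich, M. H. Quek, B. Schober, arXiv:2507.01232v3, Def. 3.2–3.3, Thm 3.5. [AbramovichQuekSchober2025]
* H. Matsumura, *Commutative Ring Theory*, Thm. 16.2. [Matsumura1987]
-/

noncomputable section

open IsLocalRing Literature.AlgebraicGeometry.Resolution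

set_option linter.dupNamespace false -- mandated namespace of this single-conjunct summit

namespace Summit.ResolutionOfSingularities.ResolutionOfSingularities.Theorems

namespace AQSHeightTwo

universe u

variable {S : Type u} [CommRing S] [IsRegularLocalRing S]

/-- **Case (C): every unit expansion of large order has an exponent under the vertex height, and its first slope `r/q`
satisfies `b q < r < (b+1) q` and `r ν < (b+1)ν² + 1`.**  (From `prepared_face`: the witness ON the line is not the vertex, so its
`(1,b)`-weight is `≥ bν + 1`; from `f ∉ 𝒥_{(b+1)ν}((x,y);(1,b+1))`: some exponent lies under the `(1, b+1)`-line.)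
[cite: AbramovichQuekSchober2025, Def. 3.2] -/
theorem caseC_slope_bounds (hdim : ringKrullDim S = (2 : ℕ)) {x y : S} (hxy : Ideal.span {x, y} = maximalIdeal S)
    {b ν : ℕ} (hb : 1 ≤ b) {f c : S} (hc : IsUnit c)
    (hprep : f - c * y ^ ν ∈ weightedMonomialIdeal ![x, y] ![1, b] (b * ν + 1))
    (hnot : f ∉ weightedMonomialIdeal ![x, y] ![1, b + 1] ((b + 1) * ν))
    {Δ : Finset (Fin 2 → ℕ)} {a : (Fin 2 → ℕ) → S} {N : ℕ} (hunit : ∀ α ∈ Δ, IsUnit (a α))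
    (hr : f - ∑ α ∈ Δ, a α * ∏ i, ![x, y] i ^ α i ∈ maximalIdeal S ^ N) (hN : (b + 1) * ν * ν + 1 ≤ N) :
    (∃ α ∈ Δ, α 1 < ν) ∧ (![0, ν] : Fin 2 → ℕ) ∈ Δ ∧
      ∀ q r : ℕ, 0 < q → (∀ α ∈ Δ, r * ν ≤ q * α 0 + r * α 1) →
        (∃ α ∈ Δ, α 1 < ν ∧ q * α 0 + r * α 1 = r * ν ∧ q ≤ ν - α 1) →
        b * q < r ∧ r < (b + 1) * q ∧ r * ν < (b + 1) * ν * ν + 1 := by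
  classical
  have hu := LocalGameEFTNewton.span_range_vecCons_eq hxy
  have hν : 1 ≤ ν := by
    rcases Nat.eq_zero_or_pos ν with h | h
    · subst h; rw [Nat.mul_zero, weightedMonomialIdeal_zero] at hnot; exact absurd Submodule.mem_top hnot
    · exact h
  have hw' : ∀ i, 0 < (![1, b + 1] : Fin 2 → ℕ) i := Fin.forall_fin_two.2 ⟨one_pos, Nat.succ_pos b⟩
  -- a witness below level `b + 1`
  have hN' : (b + 1) * ν ≤ N := by nlinarith
  obtain ⟨γ, hγ, hγlt⟩ := LocalGameEFTNewton.exists_weight_lt_of_not_mem ![x, y] hu ![1, b + 1] hw' hr hN' hnot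
  rw [LocalGameEFTNewton.weight_two] at hγlt
  have hγ1 : γ 1 < ν := by
    by_contra h; push Not at h
    have : (b + 1) * ν ≤ (b + 1) * γ 1 := Nat.mul_le_mul_left _ h
    omega
  obtain ⟨he0, hface⟩ := LocalGameEFTNewton.prepared_face hdim hxy hb hc hprep hunit hr (by nlinarith)
  refine ⟨⟨γ, hγ, hγ1⟩, he0, fun q r hq hline hw => ?_⟩
  obtain ⟨β, hβ, hβ1, hβeq, hqβ⟩ := hw
  have hνβ : 0 < ν - β 1 := Nat.sub_pos_of_lt hβ1
  have hνγ : 0 < ν - γ 1 := Nat.sub_pos_of_lt hγ1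
  -- `q β₀ = r (ν - β₁)`
  have e1 : r * (ν - β 1) = q * β 0 := by
    have h3 : r * (ν - β 1) + r * β 1 = r * ν := by rw [← Nat.mul_add, Nat.sub_add_cancel hβ1.le]
    omega
  -- `b q < r`: `β ≠ (0, ν)` so `β₀ + b β₁ ≥ bν + 1`, i.e. `β₀ > b (ν - β₁)`
  have hbq : b * q < r := by
    have hne : β ≠ ![0, ν] := fun h => by
      have : β 1 = ν := by rw [h]; rfl
      omega
    have h := hface β hβ hne
    have hβ0 : b * (ν - β 1) < β 0 := by
      have e : b * (ν - β 1) + b * β 1 = b * ν := by rw [← Nat.mul_add, Nat.sub_add_cancel hβ1.le]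
      omega
    have h2 : b * q * (ν - β 1) < r * (ν - β 1) := by
      calc b * q * (ν - β 1) = q * (b * (ν - β 1)) := by ring
        _ < q * β 0 := Nat.mul_lt_mul_of_pos_left hβ0 hq
        _ = r * (ν - β 1) := e1.symm
    exact Nat.lt_of_mul_lt_mul_right h2
  -- `r < (b+1) q`: at `γ`, `r (ν - γ₁) ≤ q γ₀ < q (b+1)(ν - γ₁)`
  have hrq : r < (b + 1) * q := by
    have hγ0 : γ 0 < (b + 1) * (ν - γ 1) := by
      have e : (b + 1) * (ν - γ 1) + (b + 1) * γ 1 = (b + 1) * ν := by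
        rw [← Nat.mul_add, Nat.sub_add_cancel hγ1.le]
      omega
    have i1 : r * (ν - γ 1) ≤ q * γ 0 := by
      have h3 : r * (ν - γ 1) + r * γ 1 = r * ν := by rw [← Nat.mul_add, Nat.sub_add_cancel hγ1.le]
      have := hline γ hγ
      omega
    have h2 : r * (ν - γ 1) < (b + 1) * q * (ν - γ 1) := by
      calc r * (ν - γ 1) ≤ q * γ 0 := i1
        _ < q * ((b + 1) * (ν - γ 1)) := Nat.mul_lt_mul_of_pos_left hγ0 hq
        _ = (b + 1) * q * (ν - γ 1) := by ring
    exact Nat.lt_of_mul_lt_mul_right h2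
  refine ⟨hbq, hrq, ?_⟩
  -- `r ν < N`: `r < (b+1) q ≤ (b+1) ν`
  have hqν : q ≤ ν := hqβ.trans (Nat.sub_le _ _)
  have h1 : r < (b + 1) * ν := lt_of_lt_of_le hrq (Nat.mul_le_mul_left _ hqν)
  have h2 : r * ν < (b + 1) * ν * ν := Nat.mul_lt_mul_of_pos_right h1 (by omega)
  omega

/-- **The slope package of case (C)** (consumed by the lex-max assembly (α4)).  `S` regular local of dimension two,
`(x, y) = 𝔪`, `f ∈ 𝔪^ν ∖ 𝔪^{ν+1}`, `f` prepared at level `b ≥ 1` in `(x, y)` and not reaching level `b + 1`.  Then there are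
COPRIME `(q, r)` with `b q < r < (b+1) q` (the vertex `δ = r/q` of AQS Def. 3.2) such that: `f ∈ 𝒥_{rν}((x,y);(q,r))`
(ADMISSIBLE); for every steeper `(q', r')` (`r q' < r' q`, `q' ≥ 1`), `f ∉ 𝒥_{r'ν}((x,y);(q',r'))` (MAXIMAL among the slopes of
`y`, at every level — res-D-pv-023's `slope_eq_of_unitExpansions` on a second expansion of order `≥ r'ν`); and some unit
expansion of `f` contains `(0, ν)`, lies on or above the `(q, r)`-line, and has a SECOND exponent ON it.
[cite: AbramovichQuekSchober2025, Def. 3.2–3.3, Thm 3.5] -/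
theorem exists_slope (hdim : ringKrullDim S = (2 : ℕ)) {x y : S} (hxy : Ideal.span {x, y} = maximalIdeal S)
    {b ν : ℕ} (hb : 1 ≤ b) {f c : S} (hfν : f ∈ maximalIdeal S ^ ν) (hfν' : f ∉ maximalIdeal S ^ (ν + 1))
    (hc : IsUnit c) (hprep : f - c * y ^ ν ∈ weightedMonomialIdeal ![x, y] ![1, b] (b * ν + 1))
    (hnot : f ∉ weightedMonomialIdeal ![x, y] ![1, b + 1] ((b + 1) * ν)) :
    ∃ q r : ℕ, 0 < q ∧ b * q < r ∧ r < (b + 1) * q ∧ Nat.Coprime q r ∧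
      f ∈ weightedMonomialIdeal ![x, y] ![q, r] (r * ν) ∧
      (∀ q' r' : ℕ, 0 < q' → r * q' < r' * q → f ∉ weightedMonomialIdeal ![x, y] ![q', r'] (r' * ν)) ∧
      ∃ (N : ℕ) (Δ : Finset (Fin 2 → ℕ)) (a : (Fin 2 → ℕ) → S), r * ν < N ∧ (∀ α ∈ Δ, IsUnit (a α)) ∧
        f - ∑ α ∈ Δ, a α * ∏ i, ![x, y] i ^ α i ∈ maximalIdeal S ^ N ∧ (![0, ν] : Fin 2 → ℕ) ∈ Δ ∧
        (∀ α ∈ Δ, r * ν ≤ q * α 0 + r * α 1) ∧ ∃ α ∈ Δ, α ≠ ![0, ν] ∧ q * α 0 + r * α 1 = r * ν := by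
  classical
  have hu := LocalGameEFTNewton.span_range_vecCons_eq hxy
  have hν : 1 ≤ ν := by
    rcases Nat.eq_zero_or_pos ν with h | h
    · subst h; rw [Nat.mul_zero, weightedMonomialIdeal_zero] at hnot; exact absurd Submodule.mem_top hnot
    · exact h
  have hνN : ν < (b + 1) * ν * ν + 1 := by
    have h1 := Nat.le_mul_self ν
    have h2 : ν * ν ≤ (b + 1) * ν * ν := by
      rw [Nat.mul_assoc]; exact Nat.le_mul_of_pos_left _ (Nat.succ_pos b)
    omega
  -- first expansion
  obtain ⟨Δ, a, hunit, -, hr⟩ := LocalGameEFTNewton.exists_unitExpansion ![x, y] hu f ((b + 1) * ν * ν + 1)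
  obtain ⟨hΔ, he0, hbounds⟩ := caseC_slope_bounds hdim hxy hb hc hprep hnot hunit hr le_rfl
  obtain ⟨q, r, hq, hqr, hcop, hline, hmemN, hsteepN, β, hβ, hβ1, hβeq, hqβ, -⟩ :=
    exists_slope_of_unitExpansion hxy hdim hunit hr hfν hfν' hνN hΔ
  obtain ⟨hbq, hrq, hrN⟩ := hbounds q r hq hline ⟨β, hβ, hβ1, hβeq, hqβ⟩
  have hr0 : 0 < r := lt_of_lt_of_le hq hqr
  refine ⟨q, r, hq, hbq, hrq, hcop, hmemN hrN.le, ?_, (b + 1) * ν * ν + 1, Δ, a, hrN, hunit, hr, he0, hline,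
    β, hβ, fun h => ?_, hβeq⟩
  · -- maximality at every level through a second expansion
    intro q' r' hq' hst hmem'
    obtain ⟨Δ₂, a₂, hunit₂, -, hr₂⟩ :=
      LocalGameEFTNewton.exists_unitExpansion ![x, y] hu f ((b + 1) * ν * ν + 1 + r' * ν)
    obtain ⟨hΔ₂, -, hbounds₂⟩ := caseC_slope_bounds hdim hxy hb hc hprep hnot hunit₂ hr₂ (by omega)
    obtain ⟨q₂, r₂, hq₂, hqr₂, hcop₂, hline₂, -, hsteepN₂, β₂, hβ₂, hβ₂1, hβ₂eq, hqβ₂, -⟩ :=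
      exists_slope_of_unitExpansion hxy hdim hunit₂ hr₂ hfν hfν' (by omega) hΔ₂
    obtain ⟨-, -, hrN₂⟩ := hbounds₂ q₂ r₂ hq₂ hline₂ ⟨β₂, hβ₂, hβ₂1, hβ₂eq, hqβ₂⟩
    have hr₂0 : 0 < r₂ := lt_of_lt_of_le hq₂ hqr₂
    obtain ⟨hqq, hrr⟩ := slope_eq_of_unitExpansions hxy hdim hunit hr hunit₂ hr₂ hq hr0 hq₂ hr₂0 hcop hcop₂ hline hline₂
      ⟨β, hβ, hβ1, hβeq⟩ ⟨β₂, hβ₂, hβ₂1, hβ₂eq⟩ hrN.le (by omega) (by omega) (by omega)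
    subst hqq; subst hrr
    exact hsteepN₂ q' r' hq' hst (by omega) hmem'
  · have : β 1 = ν := by rw [h]; rfl
    omega

end AQSHeightTwo

end Summit.ResolutionOfSingularities.ResolutionOfSingularities.Theorems

end
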